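import Summits.KontsevichZagierPeriods.Zeta5Search.WedgeDictionaryContiguityModule
import HarnessLib

/-!
# Three-term contiguity of the cellular integrals and the pointwise 2-of-3 step for `explicitPQ`;
# the STAR and PENCIL relation families in closed form (statements)

HONEST FRAMING: systematic search; no irrationality claim unless certified.
OUR work (Summit side; cell `pub-zeta5`, planner gen-1 g15, 2026-08-21; memo `pub-zeta5-gen-1/D2-CONNECTION-g15.md`).

`WedgeDictionaryContiguityModule` gives the 3-of-4 induction step for `explicitPQ` on four-point clusters in DET form
(`at_of_clusterRelation`).  The local connection of the dictionary vectors `v(a) = (Q, P̂_d, P_d)(a) ∈ ℚ³` found in g15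
is generated by THREE-TERM relations with coefficients that are products of linear forms in the dual parameters
`b = b(a)` (memo §0, §2): for a dual point `P = b(a)` at "level" `N = b₀`, slots `P₁..P₇`, and the graph with NON-EDGES
`{16,17,27,35,45,46}`,

* STAR(i,k) (within a level):  `(P_i−P_k)(N+1−P_i−P_k)·v(P) − χ_kΠ_k(P)·v(P−s_k) + χ_iΠ_i(P)·v(P−s_i) = 0`,
* PENCIL(c,i) (levels `N`, `N+2`; `P = DS c = (N+2; c+1)`):  `−P₂P₃·v(c) + P_i(N_P+1−P_i)·v(P) + χ_iΠ_i(P)·v(P−s_i) = 0`,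

`χ_i(P) = P_i` for `i ∈ {2,3}` (else `1`), `Π_i(P) = ∏_{m : (i,m) non-edge} (N+1−P_i−P_m)`; verified as exact rational
identities at 8·21 + 316 points (STAR: `code/gen1/g15/star_num.py`; PENCIL: `dstar_num.py`, `pencil_check.py`), NOT proved here.
This file PROVES the two transfer lemmas for arbitrary three-term relations — `threeTerm_of_at` (`explicitPQ` at three points
and a dictionary relation give the relation among the integrals) and the 2-of-3 INDUCTION STEP `at_of_threeTerm` — and RECORDS the
two families as named statements: `DictStar`, `DictPencil` (dictionary side; identities among `coeffU/W/V`, expected to follow from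
the tree's `coeff_update_sub`, `fourTerm_coeff_rel_UWV`, `coeffU/W/V_dsShift`) and `CellStar`, `CellPencil` (cellular side;
INTERNALLY MINTED conjectures, consequences of `explicitPQ` — `cellStar_of_explicitPQ`, `cellPencil_of_explicitPQ`).  Memo §0 (T):
the six STARs with `{i,k} ⊂ {1,2,7}` or `⊂ {3,4,5}` are integrand-trivial in Brown–Zudilin's double Barnes representation (16)–(17) and
the other fifteen are their images under the group `G ≅ S₇` of Sect. 7 (`invariance_of_converges'`); PENCIL is a genuine
creative-telescoping statement (instance certificates exist, a uniform one is open).  The slot moves in `a`-coordinates: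
`−s₁=e₁, −s₂=e₁−e₂+e₃, −s₃=e₃−e₄+e₅+e₈, −s₄=e₅, −s₅=e₆+e₈, −s₆=e₆+e₇, −s₇=e₇`, `DS = e₂+e₄` (`slotDown`, `dsUp`; `bOfA_add_slotDown`,
`bOfA_add_dsUp` PROVED).  What this file is NOT: a proof of any STAR/PENCIL instance on either side; nothing about irrationality.
-/

noncomputable section

open Finset

namespace Summit.KontsevichZagierPeriods.Zeta5Search.WedgeDictionary

open Summit.KontsevichZagierPeriods.Zeta5Search.DualSeries
open Literature.NumberTheory.Irrationality.BrownZudilin2022 (vwpDual bOfA Converges cellularIntegral QOf)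
open Literature.NumberTheory.Transcendental (zetaValue)

/-! ## 1. Three-term relations and the 2-of-3 step -/

/-- A three-term linear relation `α I(a₀) + β I(a₁) + γ I(a₂) = 0` among cellular integrals, rational coefficients. -/
def ThreeTermRel (α β γ : ℚ) (a₀ a₁ a₂ : Fin 8 → ℤ) : Prop :=
  (α : ℝ) * cellularIntegral a₀ + (β : ℝ) * cellularIntegral a₁ + (γ : ℝ) * cellularIntegral a₂ = 0

/-- The same relation for the dictionary vectors `(Q, P̂_d, P_d)` at the three points (partner indices `j₀,j₁,j₂`),
componentwise in `ℚ`. -/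
def DictThreeTerm (α β γ : ℚ) (a₀ a₁ a₂ : Fin 8 → ℤ) (j₀ j₁ j₂ : ℕ) : Prop :=
  α * (QOf a₀ : ℚ) + β * (QOf a₁ : ℚ) + γ * (QOf a₂ : ℚ) = 0 ∧
    α * dictPhat a₀ j₀ + β * dictPhat a₁ j₁ + γ * dictPhat a₂ j₂ = 0 ∧
      α * dictP a₀ j₀ + β * dictP a₁ j₁ + γ * dictP a₂ j₂ = 0

/-- `explicitPQ` at the three points and the dictionary relation give the relation among the integrals. -/
theorem threeTerm_of_at {α β γ : ℚ} {a₀ a₁ a₂ : Fin 8 → ℤ} {j₀ j₁ j₂ : ℕ}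
    (hd : DictThreeTerm α β γ a₀ a₁ a₂ j₀ j₁ j₂) (h₀ : ExplicitPQAt a₀ j₀) (h₁ : ExplicitPQAt a₁ j₁)
    (h₂ : ExplicitPQAt a₂ j₂) : ThreeTermRel α β γ a₀ a₁ a₂ := by
  obtain ⟨hq, hph, hp⟩ := hd
  have hq' : (α : ℝ) * (QOf a₀ : ℝ) + (β : ℝ) * (QOf a₁ : ℝ) + (γ : ℝ) * (QOf a₂ : ℝ) = 0 := by exact_mod_cast hq
  have hph' : (α : ℝ) * (dictPhat a₀ j₀ : ℝ) + (β : ℝ) * (dictPhat a₁ j₁ : ℝ) + (γ : ℝ) * (dictPhat a₂ j₂ : ℝ) = 0 := by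
    exact_mod_cast hph
  have hp' : (α : ℝ) * (dictP a₀ j₀ : ℝ) + (β : ℝ) * (dictP a₁ j₁ : ℝ) + (γ : ℝ) * (dictP a₂ j₂ : ℝ) = 0 := by
    exact_mod_cast hp
  unfold ThreeTermRel
  unfold ExplicitPQAt at h₀ h₁ h₂
  rw [h₀, h₁, h₂]
  linear_combination (2 * zetaValue 5 + 4 * zetaValue 3 * zetaValue 2) * hq' - 4 * zetaValue 2 * hph' - 2 * hp'

/-- **The 2-of-3 induction step.** A three-term relation among the integrals whose coefficients also kill the three
dictionary vectors, `explicitPQ` at two of the points and `γ ≠ 0` give `explicitPQ` at the third point. -/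
theorem at_of_threeTerm {α β γ : ℚ} {a₀ a₁ a₂ : Fin 8 → ℤ} {j₀ j₁ j₂ : ℕ} (hrel : ThreeTermRel α β γ a₀ a₁ a₂)
    (hd : DictThreeTerm α β γ a₀ a₁ a₂ j₀ j₁ j₂) (h₀ : ExplicitPQAt a₀ j₀) (h₁ : ExplicitPQAt a₁ j₁) (hγ : γ ≠ 0) :
    ExplicitPQAt a₂ j₂ := by
  obtain ⟨hq, hph, hp⟩ := hd
  have hq' : (α : ℝ) * (QOf a₀ : ℝ) + (β : ℝ) * (QOf a₁ : ℝ) + (γ : ℝ) * (QOf a₂ : ℝ) = 0 := by exact_mod_cast hq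
  have hph' : (α : ℝ) * (dictPhat a₀ j₀ : ℝ) + (β : ℝ) * (dictPhat a₁ j₁ : ℝ) + (γ : ℝ) * (dictPhat a₂ j₂ : ℝ) = 0 := by
    exact_mod_cast hph
  have hp' : (α : ℝ) * (dictP a₀ j₀ : ℝ) + (β : ℝ) * (dictP a₁ j₁ : ℝ) + (γ : ℝ) * (dictP a₂ j₂ : ℝ) = 0 := by
    exact_mod_cast hp
  have hγ' : (γ : ℝ) ≠ 0 := by exact_mod_cast hγ
  unfold ThreeTermRel at hrel
  unfold ExplicitPQAt at h₀ h₁ ⊢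
  rw [h₀, h₁] at hrel
  have key : (γ : ℝ) * (cellularIntegral a₂ - ((QOf a₂ : ℝ) * (2 * zetaValue 5 + 4 * zetaValue 3 * zetaValue 2) -
      4 * (dictPhat a₂ j₂ : ℝ) * zetaValue 2 - 2 * (dictP a₂ j₂ : ℝ))) = 0 := by
    linear_combination hrel - (2 * zetaValue 5 + 4 * zetaValue 3 * zetaValue 2) * hq' + 4 * zetaValue 2 * hph' + 2 * hp'
  rcases mul_eq_zero.1 key with h | h
  · exact absurd h hγ'
  · linarith

/-! ## 2. The slot moves in `a`-coordinates -/

/-- The `a`-lattice vector of the dual slot move `b ↦ b − s_i`, `i = 1,…,7` (`0` otherwise):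
`−s₁=e₁, −s₂=e₁−e₂+e₃, −s₃=e₃−e₄+e₅+e₈, −s₄=e₅, −s₅=e₆+e₈, −s₆=e₆+e₇, −s₇=e₇` (entries of `Fin 8` are `a₁,…,a₈`). -/
def slotDown (i : ℕ) : Fin 8 → ℤ :=
  if i = 1 then ![1, 0, 0, 0, 0, 0, 0, 0] else if i = 2 then ![1, -1, 1, 0, 0, 0, 0, 0]
  else if i = 3 then ![0, 0, 1, -1, 1, 0, 0, 1] else if i = 4 then ![0, 0, 0, 0, 1, 0, 0, 0]
  else if i = 5 then ![0, 0, 0, 0, 0, 1, 0, 1] else if i = 6 then ![0, 0, 0, 0, 0, 1, 1, 0]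
  else if i = 7 then ![0, 0, 0, 0, 0, 0, 1, 0] else 0

/-- The diagonal-shift move `DS = e₂ + e₄` in `a`-coordinates (`b ↦ (b₀+2; b₁+1,…,b₇+1)`). -/
def dsUp : Fin 8 → ℤ := ![0, 1, 0, 1, 0, 0, 0, 0]

/-- `b(a − s_i)`: slot `i` goes down by one, the other dual coordinates `b₀,…,b₇` are unchanged. -/
theorem bOfA_add_slotDown (a : Fin 8 → ℤ) (i : ℕ) (hi : i ∈ Icc 1 7) (n : ℕ) (hn : n ≤ 7) :
    bOfA (a + slotDown i) n = if n = i then bOfA a n - 1 else bOfA a n := by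
  simp only [mem_Icc] at hi
  obtain ⟨h1, h7⟩ := hi
  interval_cases i <;> interval_cases n <;> simp [bOfA, slotDown] <;> ring

/-- `b(a + DS) = (b₀+2; b₁+1, …, b₇+1)`. -/
theorem bOfA_add_dsUp (a : Fin 8 → ℤ) (n : ℕ) (hn : n ≤ 7) :
    bOfA (a + dsUp) n = if n = 0 then bOfA a 0 + 2 else bOfA a n + 1 := by
  interval_cases n <;> simp [bOfA, dsUp] <;> ring

/-! ## 3. The STAR and PENCIL coefficient functions (closed forms of g15) -/

/-- The non-edge partners of slot `i` in the graph with non-edges `{16,17,27,35,45,46}`. -/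
def nonEdgePartners (i : ℕ) : List ℕ :=
  if i = 1 then [6, 7] else if i = 2 then [7] else if i = 3 then [5] else if i = 4 then [5, 6]
  else if i = 5 then [3, 4] else if i = 6 then [1, 4] else if i = 7 then [1, 2] else []

/-- `χ_i(P) = P_i` for the two slots `i ∈ {2,3}` without a factorial in `ρ`, else `1`. -/
def chiOf (P : ℕ → ℤ) (i : ℕ) : ℤ := if i = 2 ∨ i = 3 then P i else 1

/-- The STAR/PENCIL fan coefficient `χ_i(P)·Π_i(P)`, `Π_i(P) = ∏_{m : (i,m) non-edge} (P₀+1−P_i−P_m)`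
(= `pref(P−s_i)/pref(P)` for Brown–Zudilin's `F₇` prefactor (35)). -/
def fanCoeff (P : ℕ → ℤ) (i : ℕ) : ℤ :=
  chiOf P i * ((nonEdgePartners i).map fun m => P 0 + 1 - P i - P m).prod

/-- The STAR apex coefficient `(P_i − P_k)(P₀ + 1 − P_i − P_k)`. -/
def starKappa (P : ℕ → ℤ) (i k : ℕ) : ℤ := (P i - P k) * (P 0 + 1 - P i - P k)

/-- The PENCIL base coefficient `−P₂P₃` at the apex `P = DS c`, written in terms of `c`: `−(c₂+1)(c₃+1)`. -/
def pencilBase (c : ℕ → ℤ) : ℤ := -((c 2 + 1) * (c 3 + 1))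

/-- The PENCIL apex coefficient `−y_i(P) = P_i(P₀+1−P_i)` at `P = DS c`, in terms of `c`: `(c_i+1)(c₀+2−c_i)`. -/
def pencilApex (c : ℕ → ℤ) (i : ℕ) : ℤ := (c i + 1) * (c 0 + 2 - c i)

/-! ## 4. The relation families as named statements -/

/-- **STAR, dictionary side** (an identity among `coeffU/W/V`; verified exactly at 168 + 316 instances, memo §2; NOT yet
proved in Lean — expected from `coeff_update_sub`, `fourTerm_coeff_rel_UWV`).  At a dual point `P = b(a)` and slots `i ≠ k`:
`κ·v(a) − χ_kΠ_k·v(a − s_k) + χ_iΠ_i·v(a − s_i) = 0` for the dictionary vectors, whenever the three points satisfy the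
hypotheses of `explicitPQ` (with their own partner indices). -/
@[conjecture] def DictStar : Prop :=
  ∀ (a : Fin 8 → ℤ) (i k j₀ j₁ j₂ : ℕ), i ∈ Icc 1 7 → k ∈ Icc 1 7 → i ≠ k →
    RegionHyp a j₀ → RegionHyp (a + slotDown k) j₁ → RegionHyp (a + slotDown i) j₂ →
      DictThreeTerm (starKappa (bOfA a) i k) (-fanCoeff (bOfA a) k) (fanCoeff (bOfA a) i)
        a (a + slotDown k) (a + slotDown i) j₀ j₁ j₂

/-- **STAR, cellular side (INTERNALLY MINTED; conjecture).** The same three-term relation among the cellular integrals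
`I(a), I(a − s_k), I(a − s_i)`.  Evidence: it follows from `explicitPQ` and `DictStar` (`cellStar_of_explicitPQ`); for
`{i,k} ⊂ {1,2,7}` or `⊂ {3,4,5}` the three Barnes kernels of (16)–(17) are linearly dependent with these coefficients
(memo §0 (T), 18/18 instances), and the other pairs are `S₇`-images (Sect. 7 of Brown–Zudilin). -/
@[conjecture] def CellStar : Prop :=
  ∀ (a : Fin 8 → ℤ) (i k j₀ j₁ j₂ : ℕ), i ∈ Icc 1 7 → k ∈ Icc 1 7 → i ≠ k →
    RegionHyp a j₀ → RegionHyp (a + slotDown k) j₁ → RegionHyp (a + slotDown i) j₂ →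
      ThreeTermRel (starKappa (bOfA a) i k) (-fanCoeff (bOfA a) k) (fanCoeff (bOfA a) i)
        a (a + slotDown k) (a + slotDown i)

/-- **PENCIL, dictionary side** (identity among `coeffU/W/V`; verified exactly at 316 instances incl. 308 boundary
points, memo §2; NOT yet proved in Lean — expected from `coeffU/W/V_dsShift` and `coeff_update_sub`).  For `c = b(a)`,
apex `P = DS c = b(a + DS)` and a slot `i`: `−P₂P₃·v(a) + P_i(P₀+1−P_i)·v(a + DS) + χ_iΠ_i(P)·v(a + DS − s_i) = 0`. -/
@[conjecture] def DictPencil : Prop :=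
  ∀ (a : Fin 8 → ℤ) (i j₀ j₁ j₂ : ℕ), i ∈ Icc 1 7 →
    RegionHyp a j₀ → RegionHyp (a + dsUp) j₁ → RegionHyp (a + dsUp + slotDown i) j₂ →
      DictThreeTerm (pencilBase (bOfA a)) (pencilApex (bOfA a) i) (fanCoeff (bOfA (a + dsUp)) i)
        a (a + dsUp) (a + dsUp + slotDown i) j₀ j₁ j₂

/-- **PENCIL, cellular side (INTERNALLY MINTED; conjecture).** The same three-term relation among
`I(a), I(a + e₂ + e₄), I(a + e₂ + e₄ − s_i)`; a consequence of `explicitPQ` and `DictPencil` (`cellPencil_of_explicitPQ`).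
Evidence: instance certificate at `a = (4,5,4,4,5,5,6,5)`, `i = 7` (memo §0 (T); `certs/cert_pencil7_45445565.json`:
`−(5/7)I(a) + (8/7)I(a+e₂+e₄) + I(a+e₂+e₄+e₇) = 0`, proportional to these coefficients).  This is the level-raising
input of the proof architecture of memo §5; a uniform certificate is OPEN. -/
@[conjecture] def CellPencil : Prop :=
  ∀ (a : Fin 8 → ℤ) (i j₀ j₁ j₂ : ℕ), i ∈ Icc 1 7 →
    RegionHyp a j₀ → RegionHyp (a + dsUp) j₁ → RegionHyp (a + dsUp + slotDown i) j₂ →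
      ThreeTermRel (pencilBase (bOfA a)) (pencilApex (bOfA a) i) (fanCoeff (bOfA (a + dsUp)) i)
        a (a + dsUp) (a + dsUp + slotDown i)

/-- `explicitPQ` and the dictionary STAR identities imply the cellular STAR relations. -/
theorem cellStar_of_explicitPQ (h : explicitPQ) (hd : DictStar) : CellStar := by
  rw [explicitPQ_iff_at] at h
  intro a i k j₀ j₁ j₂ hi hk hik h₀ h₁ h₂
  have hd' := hd a i k j₀ j₁ j₂ hi hk hik h₀ h₁ h₂
  have e := threeTerm_of_at hd' (h _ _ h₀) (h _ _ h₁) (h _ _ h₂)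
  unfold ThreeTermRel at e ⊢
  push_cast at e ⊢
  exact e

/-- `explicitPQ` and the dictionary PENCIL identities imply the cellular PENCIL relations. -/
theorem cellPencil_of_explicitPQ (h : explicitPQ) (hd : DictPencil) : CellPencil := by
  rw [explicitPQ_iff_at] at h
  intro a i j₀ j₁ j₂ hi h₀ h₁ h₂
  have hd' := hd a i j₀ j₁ j₂ hi h₀ h₁ h₂
  have e := threeTerm_of_at hd' (h _ _ h₀) (h _ _ h₁) (h _ _ h₂)
  unfold ThreeTermRel at e ⊢
  push_cast at e ⊢
  exact e

/-- **The PENCIL step of the induction** (memo §5 (C)): the cellular PENCIL relation at `(a, i)`, the dictionary PENCIL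
identity, `explicitPQ` at `a` and at `a + DS`, and `χ_iΠ_i(DS b(a)) ≠ 0` give `explicitPQ` at `a + DS − s_i`. -/
theorem at_pencilFan (hc : CellPencil) (hd : DictPencil) {a : Fin 8 → ℤ} {i j₀ j₁ j₂ : ℕ} (hi : i ∈ Icc 1 7)
    (r₀ : RegionHyp a j₀) (r₁ : RegionHyp (a + dsUp) j₁) (r₂ : RegionHyp (a + dsUp + slotDown i) j₂)
    (h₀ : ExplicitPQAt a j₀) (h₁ : ExplicitPQAt (a + dsUp) j₁) (hne : fanCoeff (bOfA (a + dsUp)) i ≠ 0) :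
    ExplicitPQAt (a + dsUp + slotDown i) j₂ := by
  have hrel := hc a i j₀ j₁ j₂ hi r₀ r₁ r₂
  have hdic := hd a i j₀ j₁ j₂ hi r₀ r₁ r₂
  have hne' : (fanCoeff (bOfA (a + dsUp)) i : ℚ) ≠ 0 := by exact_mod_cast hne
  exact at_of_threeTerm hrel hdic h₀ h₁ hne'

/-- **The STAR step of the induction**: the cellular STAR relation at `(a, i, k)`, the dictionary STAR identity,
`explicitPQ` at `a` and at `a − s_k`, and `χ_iΠ_i(b(a)) ≠ 0` give `explicitPQ` at `a − s_i`. -/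
theorem at_starFan (hc : CellStar) (hd : DictStar) {a : Fin 8 → ℤ} {i k j₀ j₁ j₂ : ℕ} (hi : i ∈ Icc 1 7)
    (hk : k ∈ Icc 1 7) (hik : i ≠ k) (r₀ : RegionHyp a j₀) (r₁ : RegionHyp (a + slotDown k) j₁)
    (r₂ : RegionHyp (a + slotDown i) j₂) (h₀ : ExplicitPQAt a j₀) (h₁ : ExplicitPQAt (a + slotDown k) j₁)
    (hne : fanCoeff (bOfA a) i ≠ 0) : ExplicitPQAt (a + slotDown i) j₂ := by
  have hrel := hc a i k j₀ j₁ j₂ hi hk hik r₀ r₁ r₂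
  have hdic := hd a i k j₀ j₁ j₂ hi hk hik r₀ r₁ r₂
  have hne' : (fanCoeff (bOfA a) i : ℚ) ≠ 0 := by exact_mod_cast hne
  exact at_of_threeTerm hrel hdic h₀ h₁ hne'

/-! ## 5. Sanity checks of the coefficient functions (values from the memo's tables) -/

/-- At `P = (13; 5,4,4,5,5,2,2)` (first row of the STAR(1,7) table of `startriv.py`): `κ = (5−2)(14−5−2) = 21`,
`χ₇Π₇ = (14−2−5)(14−2−4) = 56`, `χ₁Π₁ = (14−5−2)(14−5−2) = 49`. -/
example : starKappa (fun n => [13, 5, 4, 4, 5, 5, 2, 2].getD n 0) 1 7 = 21 ∧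
    fanCoeff (fun n => [13, 5, 4, 4, 5, 5, 2, 2].getD n 0) 7 = 56 ∧
    fanCoeff (fun n => [13, 5, 4, 4, 5, 5, 2, 2].getD n 0) 1 = 49 := by decide

/-- The `a`-moves land where the memo says: `b(4,5,4,4,5,5,6,5) = (13; 4,5,4,4,4,4,3)`, `b(… + DS) = (15; 5,6,5,5,5,5,4)`
and slot 7 of `b(… + DS − s₇)` is `3` (the PENCIL(c,7) instance of the certificate quoted above). -/
example : (List.range 8).map (bOfA ![4, 5, 4, 4, 5, 5, 6, 5]) = [13, 4, 5, 4, 4, 4, 4, 3] ∧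
    (List.range 8).map (bOfA (![4, 5, 4, 4, 5, 5, 6, 5] + dsUp)) = [15, 5, 6, 5, 5, 5, 5, 4] ∧
    bOfA (![4, 5, 4, 4, 5, 5, 6, 5] + dsUp + slotDown 7) 7 = 3 := by decide

/-- The PENCIL coefficients at `a = (4,5,4,4,5,5,6,5)`, `i = 7` are `(−30, 48, 42) = 42·(−5/7, 8/7, 1)`, the exact
instance certificate `certs/cert_pencil7_45445565.json` of the memo. -/
example : pencilBase (fun n => [13, 4, 5, 4, 4, 4, 4, 3].getD n 0) = -30 ∧
    pencilApex (fun n => [13, 4, 5, 4, 4, 4, 4, 3].getD n 0) 7 = 48 ∧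
    fanCoeff (fun n => [15, 5, 6, 5, 5, 5, 5, 4].getD n 0) 7 = 42 := by decide

end Summit.KontsevichZagierPeriods.Zeta5Search.WedgeDictionary
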